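import Summits.RiemannHypothesis.RiemannHypothesis.Theorems.WeilTwoPrimeDeflE72Base
import Literature.NumberTheory.LFunctions.WeilBlockRowsPZ
import HarnessLib

/-!
# Deflated two-prime certificate E72: the factored even inverse agrees with `D`, rows 72–75

`WeilCert.checkDnRow` (even block) for certificate E72, by `decide +kernel`. Pure proof file.
-/

noncomputable section

namespace Summit.RiemannHypothesis.RiemannHypothesis.Theorems.EvenWinsBeyondArch

open Literature.NumberTheory.LFunctions

set_option maxHeartbeats 0 in
/-- Row 72 of `DnE/LsE` is row 72 of the even `D` (certificate E72). [folklore] -/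
theorem checkDnRow0_72_weilCertDeflE72 : weilCertDeflE72Base.checkDnRow weilCertDeflE72DnE weilCertDeflE72LsE 0 72 = true := by
  decide +kernel

set_option maxHeartbeats 0 in
/-- Row 73 of `DnE/LsE` is row 73 of the even `D` (certificate E72). [folklore] -/
theorem checkDnRow0_73_weilCertDeflE72 : weilCertDeflE72Base.checkDnRow weilCertDeflE72DnE weilCertDeflE72LsE 0 73 = true := by
  decide +kernel

set_option maxHeartbeats 0 in
/-- Row 74 of `DnE/LsE` is row 74 of the even `D` (certificate E72). [folklore] -/
theorem checkDnRow0_74_weilCertDeflE72 : weilCertDeflE72Base.checkDnRow weilCertDeflE72DnE weilCertDeflE72LsE 0 74 = true := by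
  decide +kernel

set_option maxHeartbeats 0 in
/-- Row 75 of `DnE/LsE` is row 75 of the even `D` (certificate E72). [folklore] -/
theorem checkDnRow0_75_weilCertDeflE72 : weilCertDeflE72Base.checkDnRow weilCertDeflE72DnE weilCertDeflE72LsE 0 75 = true := by
  decide +kernel


end Summit.RiemannHypothesis.RiemannHypothesis.Theorems.EvenWinsBeyondArch
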